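import Summits.CriticalPhenomena.CardyFormulaZ2.Theorems.CardyComplexConeEdgePrecompactUFRSHalfPlaneArms
import Summits.CriticalPhenomena.CardyFormulaZ2.Theorems.CardySelfRefinementLagHandOffHalfPlaneTwoArmUndocked
import HarnessLib

/-!
# The loose (undocked) half-plane two-arm bound `P(hpLooseArms j 2 m R) ≤ C m / n` (HT-B2)

Registered sub-goal `hpLooseArms_two_decay` of crux stmt-CriticalPhenomena-11387
(`CardyComplexCone.EdgePrecompact`, line `qkz-strip-boundary-arm`; lead c5, wave 2, worker HTB):
for critical bond percolation on `ℤ²`, the probability that the upper half-plane carries an open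
arm AND a dual (closed) arm from the window box `[j-m, j+m] × [·, m]` to sup-distance `R`, the arms
being LOOSE (not docked on the boundary line), is at most `C m / n` whenever `1 ≤ m ≤ n`,
`K n ≤ R` — Lawler–Schramm–Werner's Lemma A.1 in the "`C_r` to `C_R`" form, exponent exactly `1`.
By the landed reduction `hpLooseArms_three_decay_of_two` (Reimer) this is the last probabilistic
input of the bridge HT (`ufrs_rect_flatThreeStrandDecay`).

## Proof

We do NOT condition on extremal crossings. The tree (crux `LagHandOff`, line
`hitting-tournament`, files `…LagHandOffHalfPlaneTwoArmUndocked*.lean`) proves the undocked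
two-arm bound (X) in the Euclidean half-annulus format with every exponent `1 - ε`
(`stub_undockedTwoArm_bound`, a separation-free bootstrap) together with the multiscale sum
`P(E(c₀; r, R)) ≤ (C_d r₀ L / 2R) Σ_{j<J} (L q)^j + q^J`, `q = A L^{-(θ+α)}`
(`stub_undockedTwoArm_sumBound`: at each scale the two arms either dock — docked bound, Werner's
counting — or produce three arms — Reimer).  Feeding the bound with exponent `θ = 1 - ε`,
`ε < α` (`α` the RSW exponent of closed dual annulus crossings) back into the sum makes
`θ + α > 1`, so for a fixed large ratio `L` the series is GEOMETRIC (`L q ≤ 1/2`) and the tail is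
`q^J ≤ L^{-J} ≤ L K_d r₀ / R`: the bound closes with exponent exactly `1`
(`undockedTwoArm_expOne_HTB`).  Finally `hpLooseArms j 2 m R` is contained in the Euclidean event
around the lattice centre `(j, -1)` with inner radius `r ≍ m` (`hpLooseArms_two_subset_HTB`:
restrict each arm to its last passage through `{dist < r}` and its first passage beyond `R/2`,
`exists_trim_walk_HTB`).

References: G. F. Lawler, O. Schramm, W. Werner, Electron. J. Probab. 7 (2002), Appendix A,
Lemma A.1 [LawlerSchrammWernerEJP2002]; H. Kesten, Comm. Math. Phys. 109 (1987), Lemma 4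
[KestenScalingCMP1987]; P. Nolin, Electron. J. Probab. 13 (2008), §4 [Nolin2008].
-/

set_option linter.unusedVariables false

namespace Summit.CriticalPhenomena.CardyFormulaZ2.Cruxes.EdgePrecompact.QkzStripBoundaryArm

open MeasureTheory Filter Set Metric
open scoped Topology BigOperators Pointwise
open Literature.Probability.LatticeModels Literature.Probability.Percolation
open Summit.CriticalPhenomena.CardyFormulaZ2.Cruxes.LagHandOff.HittingTournament

noncomputable section

/-! ## (A) The undocked two-arm bound with exponent exactly one -/

/-- **The undocked half-plane two-arm bound with exponent `1`** (Euclidean half-annulus format of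
crux `LagHandOff`, lattice centres, mesh `1`): there are `C, c_b > 0`, `K ≥ 1` such that for every
lattice point `c₀` and radii `c_b ≤ r`, `K r ≤ R`, the event "an open path and a dual-open path
cross the half-annulus `{r ≤ dist(·, c₀) ≤ R, im ≥ im c₀}` from distance `≤ 2r` to distance `≥ R/2`"
has probability `≤ C r / R`.  From `stub_undockedTwoArm_bound` (exponent `1 - ε`) and the
multiscale sum `stub_undockedTwoArm_sumBound`, whose series is geometric once `θ + α > 1`.
[cite: LawlerSchrammWernerEJP2002, Appendix A, Lemma A.1] -/
theorem undockedTwoArm_expOne_HTB : ∃ C cb K : ℝ, 0 < C ∧ 0 < cb ∧ 1 ≤ K ∧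
    ∀ (c₀ : Site 2) (r R : ℝ), cb ≤ r → K * r ≤ R →
    (bondPercolation (zdGraph 2) half).real {ω | ∃ v w f g : Site 2,
        dist (meshPoint 1 v) (meshPoint 1 c₀) ≤ 2 * r ∧ dist (meshPoint 1 f) (meshPoint 1 c₀) ≤ 2 * r ∧
        R / 2 ≤ dist (meshPoint 1 w) (meshPoint 1 c₀) ∧ R / 2 ≤ dist (meshPoint 1 g) (meshPoint 1 c₀) ∧
        ω ∈ openConnIn {v : Site 2 | r ≤ dist (meshPoint 1 v) (meshPoint 1 c₀) ∧
          dist (meshPoint 1 v) (meshPoint 1 c₀) ≤ R ∧ (meshPoint 1 c₀).im ≤ (meshPoint 1 v).im} v w ∧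
        dualConfig ω ∈ openConnIn {v : Site 2 | r ≤ dist (meshPoint 1 v) (meshPoint 1 c₀) ∧
          dist (meshPoint 1 v) (meshPoint 1 c₀) ≤ R ∧ (meshPoint 1 c₀).im ≤ (meshPoint 1 v).im} f g} ≤
      C * (r / R) := by
  obtain ⟨αd, cd, hαd, hcd, hdual⟩ := annulusDualCrossing_half_le_holds
  set ε : ℝ := min (αd / 2) (1 / 2) with hε
  have hε0 : 0 < ε := lt_min (by positivity) (by norm_num)
  obtain ⟨hεα, hεh⟩ : ε ≤ αd / 2 ∧ ε ≤ 1 / 2 := ⟨min_le_left _ _, min_le_right _ _⟩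
  obtain ⟨C, cb, K, hC, hcb, hK, hX⟩ := stub_undockedTwoArm_bound ε hε0
  set θ : ℝ := 1 - ε with hθ
  have hθ0 : 0 < θ := by rw [hθ]; linarith
  obtain ⟨Cd, Kd, hCd, hKd, hsum⟩ := stub_undockedTwoArm_sumBound hθ0 hC hcb hK hX hαd hcd hdual
  -- exponents and the ratio `L`
  set κ : ℝ := θ + αd with hκ
  have hκ1 : 1 < κ := by rw [hκ, hθ]; linarith
  set A : ℝ := 2 * C * 2 ^ θ * 32 ^ αd with hA
  have hA0 : 0 < A := by rw [hA]; positivity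
  set L : ℝ := max (max 32 (2 * K)) ((2 * A) ^ (1 / (κ - 1))) with hL
  have hLmax : max 32 (2 * K) ≤ L := le_max_left _ _
  have hL32 : 32 ≤ L := le_trans (le_max_left _ _) hLmax
  obtain ⟨hL1, hL0⟩ : 1 < L ∧ 0 < L := ⟨by linarith, by linarith⟩
  have hLκ : 2 * A ≤ L ^ (κ - 1) := by
    have hγ0 : 0 < κ - 1 := by linarith
    have h1 : (2 * A) ^ (1 / (κ - 1)) ≤ L := le_max_right _ _
    have h2 : ((2 * A) ^ (1 / (κ - 1))) ^ (κ - 1) ≤ L ^ (κ - 1) :=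
      Real.rpow_le_rpow (by positivity) h1 hγ0.le
    rwa [← Real.rpow_mul (by positivity), one_div_mul_cancel hγ0.ne', Real.rpow_one] at h2
  set q : ℝ := A * L ^ (-κ) with hq
  have hq0 : 0 ≤ q := by rw [hq]; positivity
  have hLq : L * q ≤ 1 / 2 := by
    have h1 : L * q = A * L ^ (1 - κ) := by
      rw [hq, show (1 : ℝ) - κ = 1 + -κ by ring, Real.rpow_add hL0, Real.rpow_one]; ring
    have h2 : L ^ (1 - κ) = (L ^ (κ - 1))⁻¹ := by
      rw [← Real.rpow_neg hL0.le, neg_sub]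
    have h3 : 0 < L ^ (κ - 1) := Real.rpow_pos_of_pos hL0 _
    rw [h1, h2, ← div_eq_mul_inv, div_le_iff₀ h3]
    linarith
  have hqL : q ≤ 1 / L := by
    rw [le_div_iff₀ hL0, mul_comm]; linarith
  -- the constants
  have hK' : 1 ≤ 3 * Kd * L := by
    have := mul_le_mul hKd hL1.le zero_le_one (by linarith); linarith
  refine ⟨3 * (Cd + Kd) * L, max (2 * cb) (max cd 16), 3 * Kd * L, by positivity, by positivity, hK',
    fun c₀ r R hr hR => ?_⟩
  set r₀ : ℝ := 2 * r + 9 with hr₀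
  have hr16 : 16 ≤ r := le_trans ((le_max_right _ _).trans (le_max_right _ _)) hr
  have hr₀0 : 0 < r₀ := by rw [hr₀]; linarith
  have hr₀3 : r₀ ≤ 3 * r := by rw [hr₀]; linarith
  set X : ℝ := R / (Kd * r₀) with hX'
  have hKr : 0 < Kd * r₀ := by positivity
  have hXL : L ≤ X := by
    rw [hX', le_div_iff₀ hKr]
    calc L * (Kd * r₀) ≤ L * (Kd * (3 * r)) := by gcongr
      _ = 3 * Kd * L * r := by ring
      _ ≤ R := hR
  obtain ⟨hX1, hX0⟩ : 1 ≤ X ∧ 0 < X := ⟨le_trans hL1.le hXL, by linarith⟩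
  have hRX : R = X * (Kd * r₀) := by rw [hX', div_mul_cancel₀ _ hKr.ne']
  have hR0 : 0 < R := by rw [hRX]; positivity
  -- the number of scales
  have hexJ : ∃ j : ℕ, X < L ^ (j + 1) := by
    obtain ⟨n, hn⟩ := pow_unbounded_of_one_lt X hL1
    exact ⟨n, hn.trans_le (pow_le_pow_right₀ hL1.le (Nat.le_succ n))⟩
  classical
  set J := Nat.find hexJ with hJ
  have hJspec : X < L ^ (J + 1) := Nat.find_spec hexJ
  have hYX : L ^ J ≤ X := by
    rcases Nat.eq_zero_or_pos J with h0 | hpos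
    · rw [h0, pow_zero]; exact hX1
    · have := Nat.find_min hexJ (show J - 1 < J by omega)
      rw [not_lt, Nat.sub_add_cancel hpos] at this
      exact this
  have hRJ : Kd * (2 * r + 9) * L ^ J ≤ R := by
    have : L ^ J * (Kd * r₀) ≤ X * (Kd * r₀) := mul_le_mul_of_nonneg_right hYX hKr.le
    rw [← hRX] at this
    rw [← hr₀]; linarith
  have hmain := hsum L hLmax c₀ r R J hr hRJ
  have hκneg : A * L ^ (-κ) = 2 * C * 2 ^ θ * 32 ^ αd * L ^ (-(θ + αd)) := by rw [hA, hκ]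
  rw [← hκneg, ← hq] at hmain
  -- the geometric series
  have hS : ∑ j ∈ Finset.range J, (L * q) ^ j ≤ 2 := by
    have h1 : ∑ j ∈ Finset.range J, (L * q) ^ j ≤ ∑ j ∈ Finset.range J, (1 / 2 : ℝ) ^ j :=
      Finset.sum_le_sum fun j _ => pow_le_pow_left₀ (by positivity) hLq j
    have h2 : ∑ j ∈ Finset.range J, (1 / 2 : ℝ) ^ j ≤ (1 / 2 : ℝ) ^ 0 / (1 - 1 / 2) := by
      rw [Finset.range_eq_Ico]; exact geom_sum_Ico_le_of_lt_one (by norm_num) (by norm_num)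
    have h3 : (1 / 2 : ℝ) ^ 0 / (1 - 1 / 2) = 2 := by norm_num
    linarith
  -- the tail
  have hT : q ^ J ≤ L * (Kd * r₀) / R := by
    have h1 : q ^ J ≤ (1 / L) ^ J := pow_le_pow_left₀ hq0 hqL J
    have h2 : (1 / L) ^ J = 1 / L ^ J := by rw [one_div_pow]
    have hLJ0 : 0 < L ^ J := pow_pos hL0 J
    have h3 : 1 / L ^ J ≤ L / X := by
      rw [div_le_div_iff₀ hLJ0 hX0, one_mul, ← pow_succ']; exact hJspec.le
    have h4 : L / X = L * (Kd * r₀) / R := by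
      rw [hX', div_div_eq_mul_div]
    exact (h1.trans h2.le).trans (h3.trans h4.le)
  -- assemble
  have hfirst : Cd * (2 * r + 9) * L / (2 * R) * ∑ j ∈ Finset.range J, (L * q) ^ j ≤ Cd * r₀ * L / R := by
    rw [← hr₀]
    calc Cd * r₀ * L / (2 * R) * ∑ j ∈ Finset.range J, (L * q) ^ j ≤ Cd * r₀ * L / (2 * R) * 2 :=
          mul_le_mul_of_nonneg_left hS (by positivity)
      _ = Cd * r₀ * L / R := by field_simp
  calc _ ≤ _ := hmain
    _ ≤ Cd * r₀ * L / R + L * (Kd * r₀) / R := add_le_add hfirst hT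
    _ = (Cd + Kd) * L * r₀ / R := by ring
    _ ≤ (Cd + Kd) * L * (3 * r) / R := by gcongr
    _ = 3 * (Cd + Kd) * L * (r / R) := by ring

/-! ## (B) Loose arms give crossings of the Euclidean half-annulus -/

/-- Along an edge of `ℤ²` the distance of the mesh-`1` points to a fixed point changes by at most
`1`. -/
theorem dist_meshPoint_le_of_adj_HTB {u v : Site 2} (h : (zdGraph 2).Adj u v) (x : ℂ) :
    dist (meshPoint 1 v) x ≤ dist (meshPoint 1 u) x + 1 := by
  have h1 : dist (meshPoint 1 v) (meshPoint 1 u) ≤ 1 := by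
    rw [Complex.dist_eq]
    refine (Complex.norm_le_abs_re_add_abs_im _).trans ?_
    rw [Complex.sub_re, Complex.sub_im, meshPoint_re, meshPoint_re, meshPoint_im, meshPoint_im]
    obtain ⟨k, rfl | rfl⟩ := (zdGraph_adj_iff u v).1 h <;> fin_cases k <;> simp
  have h2 := dist_triangle (meshPoint 1 v) (meshPoint 1 u) x
  linarith

/-- **Trimming a walk to a crossing of an annulus of levels.**  For a function `d` on sites that
increases by at most `1` along edges, a walk from `{d < a}` to `{b ≤ d}` (`a + 1 ≤ b`) contains a
sub-walk (same edges, same vertices) from a vertex with `a ≤ d < a + 1` to a vertex with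
`b ≤ d < b + 1`, all of whose vertices satisfy `a ≤ d < b + 1`: the piece between the last passage
below level `a` and the next passage above level `b` (`exists_prefix_exit`, twice). -/
theorem exists_trim_walk_HTB (d : Site 2 → ℝ) (hd : ∀ u v : Site 2, (zdGraph 2).Adj u v → d v ≤ d u + 1)
    {s t : Site 2} (P : (zdGraph 2).Walk s t) {a b : ℝ} (hs : d s < a) (hab : a + 1 ≤ b) (ht : b ≤ d t) :
    ∃ (v w : Site 2) (Q : (zdGraph 2).Walk v w), a ≤ d v ∧ d v < a + 1 ∧ b ≤ d w ∧ d w < b + 1 ∧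
      (∀ u ∈ Q.support, u ∈ P.support ∧ a ≤ d u ∧ d u < b + 1) ∧ (∀ e ∈ Q.edges, e ∈ P.edges) := by
  -- the last entrance into `{a ≤ d}`: the first exit of the reversed walk
  obtain ⟨x, z, q₁, hxz, hz, hq₁A, hq₁supp, hq₁edges, -⟩ :=
    exists_prefix_exit (A := {u : Site 2 | a ≤ d u}) P.reverse (show a ≤ d t by linarith)
      (show ¬ (a ≤ d s) from not_le.2 hs)
  have hz' : d z < a := not_le.1 hz
  have hx : d x < a + 1 := by have := hd z x hxz.symm; linarith
  have hsuppP : ∀ u ∈ q₁.support, u ∈ P.support := fun u hu => by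
    have := hq₁supp u hu; rwa [SimpleGraph.Walk.support_reverse, List.mem_reverse] at this
  have hedgesP : ∀ e ∈ q₁.edges, e ∈ P.edges := fun e he => by
    have := hq₁edges e he; rwa [SimpleGraph.Walk.edges_reverse, List.mem_reverse] at this
  -- the first exit of `q₁.reverse` from `{d < b}`
  have hxB : x ∈ {u : Site 2 | d u < b} := by show d x < b; linarith
  have htB : t ∉ {u : Site 2 | d u < b} := by show ¬ (d t < b); exact not_lt.2 ht
  obtain ⟨x', z', q₂, hx'z', hz'B, hq₂B, hq₂supp, hq₂edges, hlast⟩ := exists_prefix_exit q₁.reverse hxB htB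
  have hz'b : b ≤ d z' := not_lt.1 hz'B
  have hx'b : d x' < b := hq₂B x' q₂.end_mem_support
  have hz'lt : d z' < b + 1 := by have := hd x' z' hx'z'; linarith
  have hsupp₂ : ∀ u ∈ q₂.support, u ∈ q₁.support := fun u hu => by
    have := hq₂supp u hu; rwa [SimpleGraph.Walk.support_reverse, List.mem_reverse] at this
  have hedges₂ : ∀ e ∈ q₂.edges, e ∈ q₁.edges := fun e he => by
    have := hq₂edges e he; rwa [SimpleGraph.Walk.edges_reverse, List.mem_reverse] at this
  have hlast' : s(x', z') ∈ q₁.edges := by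
    rwa [SimpleGraph.Walk.edges_reverse, List.mem_reverse] at hlast
  have hz'q₁ : z' ∈ q₁.support := q₁.snd_mem_support_of_mem_edges hlast'
  refine ⟨x, z', q₂.concat hx'z', hq₁A x q₁.end_mem_support, hx, hz'b, hz'lt, fun u hu => ?_, fun e he => ?_⟩
  · rw [SimpleGraph.Walk.support_concat, List.mem_append, List.mem_singleton] at hu
    rcases hu with hu | rfl
    · have h1 := hq₂B u hu
      exact ⟨hsuppP u (hsupp₂ u hu), hq₁A u (hsupp₂ u hu), by simp only [Set.mem_setOf_eq] at h1; linarith⟩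
    · exact ⟨hsuppP _ hz'q₁, hq₁A _ hz'q₁, hz'lt⟩
  · rw [SimpleGraph.Walk.edges_concat, List.concat_eq_append, List.mem_append, List.mem_singleton] at he
    rcases he with he | rfl
    · exact hedgesP e (hedges₂ e he)
    · exact hedgesP _ hlast'

/-- **One loose arm gives a crossing of the Euclidean half-annulus.**  A walk of `ω'`-open edges
through sites of height `≥ -1`, started in the window box (`|x₀ - j| ≤ m`, height `≤ m`) and
ended at sup-distance `≥ R` from `(j, 0)`, contains an `ω'`-open crossing of the half-annulus
`{r ≤ dist(·, c₀) ≤ R, im ≥ -1}` around `c₀ = (j, -1)` from distance `≤ 2r` to distance `≥ R/2`,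
provided `2m + 1 < r` and `2(r + 1) ≤ R`. -/
theorem arm_trim_HTB {ω' : BondConfig (Site 2)} (c₀ : Site 2) {j : ℤ} {m R : ℕ} {r : ℝ}
    (hc0 : c₀ 0 = j) (hc1 : c₀ 1 = -1) (hmr : 2 * (m : ℝ) + 1 < r) (hrR : 2 * (r + 1) ≤ R)
    {x y : Site 2} (W : (zdGraph 2).Walk x y)
    (hsupp : ∀ u ∈ W.support, (-1 : ℤ) ≤ u 1) (hedges : ∀ e ∈ W.edges, e ∈ ω')
    (hx : j - m ≤ x 0 ∧ x 0 ≤ j + m ∧ x 1 ≤ m) (hy : Z2HalfPlane.Far R j y) :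
    ∃ v w : Site 2, dist (meshPoint 1 v) (meshPoint 1 c₀) ≤ 2 * r ∧
      (R : ℝ) / 2 ≤ dist (meshPoint 1 w) (meshPoint 1 c₀) ∧
      ω' ∈ openConnIn {v : Site 2 | r ≤ dist (meshPoint 1 v) (meshPoint 1 c₀) ∧
          dist (meshPoint 1 v) (meshPoint 1 c₀) ≤ R ∧ (meshPoint 1 c₀).im ≤ (meshPoint 1 v).im} v w := by
  set d : Site 2 → ℝ := fun u => dist (meshPoint 1 u) (meshPoint 1 c₀) with hd
  have hdadj : ∀ u v : Site 2, (zdGraph 2).Adj u v → d v ≤ d u + 1 :=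
    fun u v huv => dist_meshPoint_le_of_adj_HTB huv _
  have hdeq : ∀ u : Site 2, d u = ‖meshPoint 1 (u + -c₀)‖ := fun u => by
    show dist (meshPoint 1 u) (meshPoint 1 c₀) = _
    rw [meshPoint_add_neg, dist_eq_norm]
  -- the start is close
  have hx1 : (-1 : ℤ) ≤ x 1 := hsupp x W.start_mem_support
  have hdx : d x < r := by
    rw [hdeq]
    refine lt_of_le_of_lt (norm_meshPoint_le_abs_add _) ?_
    have h0 : ((((x + -c₀) 0 : ℤ)) : ℝ) = (x 0 : ℝ) - j := by
      rw [← hc0]; push_cast [Pi.add_apply, Pi.neg_apply]; ring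
    have h1 : ((((x + -c₀) 1 : ℤ)) : ℝ) = (x 1 : ℝ) + 1 := by
      push_cast [Pi.add_apply, Pi.neg_apply, hc1]; ring
    rw [h0, h1]
    obtain ⟨hxa, hxb, hxc⟩ := hx
    have ha : ((j : ℤ) : ℝ) - m ≤ x 0 := by exact_mod_cast hxa
    have hb : ((x 0 : ℤ) : ℝ) ≤ j + m := by exact_mod_cast hxb
    have hc : ((x 1 : ℤ) : ℝ) ≤ m := by exact_mod_cast hxc
    have he : (-1 : ℝ) ≤ x 1 := by exact_mod_cast hx1
    have hA : |((x 0 : ℤ) : ℝ) - j| ≤ m := abs_le.2 ⟨by linarith, by linarith⟩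
    have hB : |((x 1 : ℤ) : ℝ) + 1| ≤ m + 1 := by rw [abs_of_nonneg (by linarith)]; linarith
    linarith
  -- the end is far
  have hdy : (R : ℝ) ≤ d y := by
    rw [hdeq]
    obtain ⟨hA, hB⟩ := abs_coord_le_norm (y + -c₀)
    have h0 : ((((y + -c₀) 0 : ℤ)) : ℝ) = (y 0 : ℝ) - j := by
      rw [← hc0]; push_cast [Pi.add_apply, Pi.neg_apply]; ring
    have h1 : ((((y + -c₀) 1 : ℤ)) : ℝ) = (y 1 : ℝ) + 1 := by
      push_cast [Pi.add_apply, Pi.neg_apply, hc1]; ring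
    rw [h0] at hA
    rw [h1] at hB
    rcases hy with hy | hy
    · have : (R : ℝ) ≤ |((y 0 : ℤ) : ℝ) - j| := by exact_mod_cast hy
      linarith
    · have : (R : ℝ) ≤ (y 1 : ℝ) := by exact_mod_cast hy
      have : (R : ℝ) + 1 ≤ |((y 1 : ℤ) : ℝ) + 1| := by rw [abs_of_nonneg (by linarith)]; linarith
      linarith
  -- trim
  have hR2 : (R : ℝ) / 2 ≤ d y := by
    have : (0 : ℝ) ≤ R := by positivity
    linarith
  obtain ⟨v, w, Q, hva, hva', hwb, hwb', hQsupp, hQedges⟩ :=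
    exists_trim_walk_HTB d hdadj W hdx (show r + 1 ≤ (R : ℝ) / 2 by linarith) hR2
  refine ⟨v, w, by show d v ≤ 2 * r; linarith, hwb, mem_openConnIn_of_walk Q (fun u hu => ?_)
    fun e he => hedges e (hQedges e he)⟩
  obtain ⟨huP, hua, hub⟩ := hQsupp u hu
  refine ⟨hua, by show d u ≤ R; linarith, ?_⟩
  have := hsupp u huP
  simp only [meshPoint_im, one_mul, hc1]
  exact_mod_cast this

/-- **Loose arms are crossings of the Euclidean half-annulus**: for `c₀ = (j, -1)`, `2m + 1 < r`
and `2(r + 1) ≤ R`, the loose two-arm event `hpLooseArms j 2 m R` is contained in the undocked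
two-arm event of crux `LagHandOff` around `c₀` at mesh `1` with radii `r, R` (one arm is open, the
other dual, since the two colours differ; each is trimmed by `arm_trim_HTB`, dual steps crossing
closed edges being `dualConfig`-open, `Z2HalfPlane.mem_dualConfig_iff_sepEdge_notMem`). -/
theorem hpLooseArms_two_subset_HTB (c₀ : Site 2) {j : ℤ} {m R : ℕ} {r : ℝ}
    (hc0 : c₀ 0 = j) (hc1 : c₀ 1 = -1) (hmr : 2 * (m : ℝ) + 1 < r) (hrR : 2 * (r + 1) ≤ R) :
    hpLooseArms j 2 m R ⊆ {ω | ∃ v w f g : Site 2,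
        dist (meshPoint 1 v) (meshPoint 1 c₀) ≤ 2 * r ∧ dist (meshPoint 1 f) (meshPoint 1 c₀) ≤ 2 * r ∧
        (R : ℝ) / 2 ≤ dist (meshPoint 1 w) (meshPoint 1 c₀) ∧ (R : ℝ) / 2 ≤ dist (meshPoint 1 g) (meshPoint 1 c₀) ∧
        ω ∈ openConnIn {v : Site 2 | r ≤ dist (meshPoint 1 v) (meshPoint 1 c₀) ∧
          dist (meshPoint 1 v) (meshPoint 1 c₀) ≤ R ∧ (meshPoint 1 c₀).im ≤ (meshPoint 1 v).im} v w ∧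
        dualConfig ω ∈ openConnIn {v : Site 2 | r ≤ dist (meshPoint 1 v) (meshPoint 1 c₀) ∧
          dist (meshPoint 1 v) (meshPoint 1 c₀) ≤ R ∧ (meshPoint 1 c₀).im ≤ (meshPoint 1 v).im} f g} := by
  intro ω hω
  obtain ⟨κ, x, y, W, ⟨a, b, hab⟩, harm, -⟩ := hω
  have hopen : ∀ c, κ c = true → ∃ v w : Site 2, dist (meshPoint 1 v) (meshPoint 1 c₀) ≤ 2 * r ∧
      (R : ℝ) / 2 ≤ dist (meshPoint 1 w) (meshPoint 1 c₀) ∧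
      ω ∈ openConnIn {v : Site 2 | r ≤ dist (meshPoint 1 v) (meshPoint 1 c₀) ∧
          dist (meshPoint 1 v) (meshPoint 1 c₀) ≤ R ∧ (meshPoint 1 c₀).im ≤ (meshPoint 1 v).im} v w := by
    intro c hc
    obtain ⟨hxc, hyc, hT, -⟩ := harm c
    obtain ⟨hsup, hed⟩ := hT hc
    exact arm_trim_HTB c₀ hc0 hc1 hmr hrR (W c)
      (fun u hu => by have := (Z2HalfPlane.mem_siteBox.1 (hsup u hu)).2.1; omega) hed hxc hyc
  have hdual : ∀ c, κ c = false → ∃ f g : Site 2, dist (meshPoint 1 f) (meshPoint 1 c₀) ≤ 2 * r ∧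
      (R : ℝ) / 2 ≤ dist (meshPoint 1 g) (meshPoint 1 c₀) ∧
      dualConfig ω ∈ openConnIn {v : Site 2 | r ≤ dist (meshPoint 1 v) (meshPoint 1 c₀) ∧
          dist (meshPoint 1 v) (meshPoint 1 c₀) ≤ R ∧ (meshPoint 1 c₀).im ≤ (meshPoint 1 v).im} f g := by
    intro c hc
    obtain ⟨hxc, hyc, -, hF⟩ := harm c
    obtain ⟨hsup, hdarts⟩ := hF hc
    refine arm_trim_HTB c₀ hc0 hc1 hmr hrR (W c)
      (fun u hu => (Z2HalfPlane.mem_faceBox.1 (hsup u hu)).2.1) (fun e he => ?_) hxc hyc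
    rw [SimpleGraph.Walk.edges, List.mem_map] at he
    obtain ⟨d, hd, rfl⟩ := he
    exact (Z2HalfPlane.mem_dualConfig_iff_sepEdge_notMem d.adj).2 (hdarts d hd)
  -- the two colours differ: one arm is open, the other dual
  have hcol : ∃ c c' : Fin 2, κ c = true ∧ κ c' = false := by
    cases hka : κ a <;> cases hkb : κ b
    · exact absurd (hka.trans hkb.symm) hab
    · exact ⟨b, a, hkb, hka⟩
    · exact ⟨a, b, hka, hkb⟩
    · exact absurd (hka.trans hkb.symm) hab
  obtain ⟨c, c', hc, hc'⟩ := hcol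
  obtain ⟨v, w, hv, hw, hvw⟩ := hopen c hc
  obtain ⟨f, g, hf, hg, hfg⟩ := hdual c' hc'
  exact ⟨v, w, f, g, hv, hf, hw, hg, hvw, hfg⟩

/-! ## (C) The registered stub -/

/-- **HT-B2 — the loose (undocked) half-plane two-arm bound for critical bond percolation on
`ℤ²`**: there are `C > 0` and `K ≥ 1` such that for all `j` and all `1 ≤ m ≤ n`, `K n ≤ R`, the
probability that the upper half-plane carries an open arm and a dual arm from the window box
`[j-m, j+m] × [·, m]` to sup-distance `R` (loose: no docking on the boundary line) is at most
`C m / n` (Lawler–Schramm–Werner's Lemma A.1 in the "`C_r` to `C_R`" form).  By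
`hpLooseArms_two_subset_HTB` and the exponent-one Euclidean bound `undockedTwoArm_expOne_HTB`
with inner radius `r = c_b + 4m`. [cite: LawlerSchrammWernerEJP2002, Appendix A, Lemma A.1] -/
theorem hpLooseArms_two_decay : ∃ C : ℝ, 0 < C ∧ ∃ K : ℕ, 1 ≤ K ∧ ∀ (j : ℤ) (m n R : ℕ), 1 ≤ m → m ≤ n → K * n ≤ R → (bondPercolation (zdGraph 2) half).real (hpLooseArms j 2 m R) ≤ C * m / n := by
  obtain ⟨C, cb, K, hC, hcb, hK, hbound⟩ := undockedTwoArm_expOne_HTB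
  have hKK : (0 : ℝ) < (2 * K + 4) * (cb + 6) := by positivity
  refine ⟨C * (cb + 6), by positivity, ⌈(2 * K + 4) * (cb + 6)⌉₊,
    Nat.succ_le_of_lt (Nat.lt_ceil.2 (by simpa using hKK)), fun j m n R hm hmn hR => ?_⟩
  set μ := bondPercolation (zdGraph 2) half with hμ
  have hm1 : (1 : ℝ) ≤ m := by exact_mod_cast hm
  obtain ⟨hmn', hn0⟩ : (m : ℝ) ≤ n ∧ (0 : ℝ) < n := ⟨by exact_mod_cast hmn, by exact_mod_cast (show 0 < n by omega)⟩
  have hRK : (2 * K + 4) * (cb + 6) * n ≤ R := by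
    have h1 : ((⌈(2 * K + 4) * (cb + 6)⌉₊ * n : ℕ) : ℝ) ≤ R := by exact_mod_cast hR
    push_cast at h1
    have h2 : (2 * K + 4) * (cb + 6) ≤ ⌈(2 * K + 4) * (cb + 6)⌉₊ := Nat.le_ceil _
    have h3 := mul_le_mul_of_nonneg_right h2 hn0.le
    linarith
  have hRm : (2 * K + 4) * (cb + 6) * m ≤ R := le_trans (mul_le_mul_of_nonneg_left hmn' hKK.le) hRK
  have h36 : (1 : ℝ) ≤ (2 * K + 4) * (cb + 6) := by nlinarith
  -- the inner radius
  set r : ℝ := cb + 4 * m with hr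
  have hmr : 2 * (m : ℝ) + 1 < r := by rw [hr]; linarith
  have hcbr : cb ≤ r := by rw [hr]; linarith
  have hr6 : r + 1 ≤ (cb + 6) * m := by rw [hr]; nlinarith
  have hcb6 : (0 : ℝ) ≤ (cb + 6) * m := by positivity
  have hrR : 2 * (r + 1) ≤ R := by nlinarith
  have hKr : K * r ≤ R := by nlinarith
  have hRn : (n : ℝ) ≤ R := by have := mul_le_mul_of_nonneg_right h36 hn0.le; linarith
  have hR0 : (0 : ℝ) < R := by linarith
  -- inclusion and the Euclidean bound around `c₀ = (j, -1)`
  have hsub := hpLooseArms_two_subset_HTB (j := j) (m := m) (R := R) (![j, -1] : Site 2) rfl rfl hmr hrR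
  have hE := hbound (![j, -1] : Site 2) r R hcbr hKr
  calc μ.real (hpLooseArms j 2 m R) ≤ _ := measureReal_mono hsub (measure_ne_top _ _)
    _ ≤ C * (r / R) := hE
    _ ≤ C * ((cb + 6) * m / n) := by
        refine mul_le_mul_of_nonneg_left ?_ hC.le
        rw [div_le_div_iff₀ hR0 hn0]
        have h1 : r ≤ (cb + 6) * m := by linarith
        have h2 : (0 : ℝ) ≤ (cb + 6) * m := by positivity
        nlinarith
    _ = C * (cb + 6) * m / n := by ring

end

end Summit.CriticalPhenomena.CardyFormulaZ2.Cruxes.EdgePrecompact.QkzStripBoundaryArm
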